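import Literature.Probability.LatticeModels.GlauberTwoBlockLogSobolev
import HarnessLib

/-!
# The log-Sobolev constant of a volume from those of overlapping halves, with general averaging strips
# ([Mar99] Theorem 4.6, (4.20)–(4.25)), PROVED modulo the gradient bound of Lemma 4.7

Topic `Literature/Probability/LatticeModels`; cell `ym-ir`, seat lit-3 (census rows B2/B4).  Theorems only
(D-0026).  This is the tree's `Glauber.logSobolevIneq_of_twoBlock_family` ([Mar99] Theorem 4.6, proof p0190 L18 –
p0191 L27) with ONE generalisation needed to feed it the gradient bound of Lemma 4.7 as it is actually proved
(Corollary 4.9 in `GlauberBoundaryGradientUniform`): the error term `k₁ μ_V^τ(|∇ f|²)` of Lemma 4.7 is carried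
by pairwise disjoint strips `O_n ⊇ A_n ∩ B_n` (the overlap TOGETHER WITH the `r`-strip `A_n ∩ ∂_r^+B_n`, where
Corollary 4.9's constant `k` multiplies `μ(|∇_x f|²)`; the printed statement of Lemma 4.7, p0191 L16–19, writes
the error on the overlap `R_n^{bot} ∩ R_n^{top}` only) — the averaging (4.23)–(4.24) over `n` is unchanged
(`le_add_mul_dirichlet_div_of_disjoint` takes any disjoint family).  Conclusion: a log-Sobolev inequality for
`μ_V^τ` with constant `C₁ (1 + 1/N) + e² c_A k₁ / N`, `C₁ = max(c_B + e² c_A η, e² c_A)`, exactly as in the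
overlap version.  SIBLING-SETTING material; the Yang–Mills gap is not touched.
[cite: Martinelli1999, Theorem 4.6, proof, (4.20)–(4.25)]
-/

open MeasureTheory ProbabilityTheory Finset Filter

noncomputable section

namespace Literature.Probability.LatticeModels

namespace Glauber

variable {d : ℕ} {γ : Specification (Site d) ℤˣ}

set_option maxHeartbeats 1600000 in
/-- **[Mar99] Theorem 4.6, (4.20)–(4.25), modulo Lemma 4.7, with general disjoint averaging strips
`O_n ⊇ A_n ∩ B_n`**: see the module docstring. [cite: Martinelli1999, Theorem 4.6, proof, (4.20)–(4.25)] -/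
theorem logSobolevIneq_of_twoBlock_family_strips (hγ : IsSpecification γ) {V : Finset (Site d)} (τ : Site d → ℤˣ)
    {N : ℕ} (hN : 0 < N) (A B O : ℕ → Finset (Site d)) (hBV : ∀ n, n < N → B n ⊆ V)
    (hcover : ∀ n, n < N → A n ∪ B n = V) (hO : ∀ n, n < N → A n ∩ B n ⊆ O n) (hOV : ∀ n, n < N → O n ⊆ V)
    (hdisj : ∀ n n', n < N → n' < N → n ≠ n' → Disjoint (O n) (O n'))
    {cA cB : ℝ} (hcA : 0 ≤ cA) (hcB : 0 ≤ cB)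
    (hLB : ∀ n, n < N → ∀ σ : Site d → ℤˣ, LogSobolevIneq (γ (B n) σ) (B n) cB)
    (hLA : ∀ n, n < N → LogSobolevIneq (γ (A n) τ) (A n) cA)
    {e : NNReal}
    (hdom : ∀ n, n < N → ∀ E : Set (Site d → ℤˣ), MeasurableSet E →
      DependsOn (· ∈ E) ((↑(B n) : Set (Site d))ᶜ) →
      γ V τ E ≤ e * γ (A n) τ E ∧ γ (A n) τ E ≤ e * γ V τ E)
    {k₁ η : ℝ} (hk₁ : 0 ≤ k₁) (hη : 0 ≤ η)
    (h47 : ∀ n, n < N → ∀ f : (Site d → ℤˣ) → ℝ, Measurable f → (∃ C : ℝ, ∀ σ, |f σ| ≤ C) → (∀ σ, 0 < f σ) →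
      ∫ σ, gradSq (A n) (fun ω => Real.sqrt (bavg γ (B n) (fun ω' => f ω' ^ 2) ω)) σ ∂(γ V τ) ≤
        ∫ σ, gradSq (A n) f σ ∂(γ V τ) + k₁ * ∫ σ, gradSq (O n) f σ ∂(γ V τ) +
          η * ∫ σ, gradSq (B n) f σ ∂(γ V τ)) :
    LogSobolevIneq (γ V τ) V
      (max (cB + (e : ℝ) ^ 2 * cA * η) ((e : ℝ) ^ 2 * cA) * (1 + 1 / N) + (e : ℝ) ^ 2 * cA * k₁ / N) := by
  classical
  haveI : IsProbabilityMeasure (γ V τ) := hγ.isProbability V τ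
  intro f hf hbdd hpos
  obtain ⟨C, hC⟩ := hbdd
  have hC0 : 0 ≤ C := (abs_nonneg _).trans (hC τ)
  set C₁ : ℝ := max (cB + (e : ℝ) ^ 2 * cA * η) ((e : ℝ) ^ 2 * cA) with hC₁
  have hC₁0 : 0 ≤ C₁ := le_max_of_le_right (by positivity)
  set X : ℝ := ∫ σ, f σ ^ 2 * Real.log (f σ) ∂(γ V τ) -
    (∫ σ, f σ ^ 2 ∂(γ V τ)) * Real.log (Real.sqrt (∫ σ, f σ ^ 2 ∂(γ V τ))) with hX
  -- integrability of the Dirichlet pieces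
  have hgi : ∀ Λ : Finset (Site d), Integrable (gradSq Λ f) (γ V τ) := fun Λ =>
    Integrable.of_bound (measurable_gradSq Λ hf).aestronglyMeasurable (4 * Λ.card * C ^ 2)
      (Eventually.of_forall fun σ => by
        rw [Real.norm_eq_abs, abs_of_nonneg (gradSq_nonneg _ _ _)]; exact gradSq_le Λ hC σ)
  -- the per-`n` bound (4.20) + (4.21) + Lemma 4.7:  `X ≤ C₁ ½μ|∇_V f|² + (C₁ + e² cA k₁) ½ μ|∇_{O_n} f|²`
  have hper : ∀ n, n < N → X ≤ C₁ * ((1 / 2) * ∫ σ, gradSq V f σ ∂(γ V τ)) +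
      (C₁ + (e : ℝ) ^ 2 * cA * k₁) * ((1 / 2) * ∫ σ, gradSq (O n) f σ ∂(γ V τ)) := by
    intro n hn
    -- (4.20)
    have h20 := integral_sq_mul_log_le_of_condLSI hγ (hBV n hn) τ (hLB n hn) hf hC hpos
    -- the function `g_n`
    set q : (Site d → ℤˣ) → ℝ := bavg γ (B n) (fun ω => f ω ^ 2) with hq
    set g : (Site d → ℤˣ) → ℝ := fun σ => Real.sqrt (q σ) with hg
    have hqm : Measurable q := measurable_bavg hγ (B n) (hf.pow_const 2)
    have hgm : Measurable g := hqm.sqrt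
    have hq_pos : ∀ σ, 0 < q σ := by
      intro σ
      haveI := hγ.isProbability (B n) σ
      rw [hq]; unfold bavg
      rw [integral_pos_iff_support_of_nonneg_ae (Eventually.of_forall fun ω => sq_nonneg (f ω))
        (integrable_sq_of_bound _ hf hC)]
      have : Function.support (fun ω => f ω ^ 2) = Set.univ := by
        ext ω; simp [(hpos ω).ne']
      rw [this, measure_univ]; norm_num
    have hg_pos : ∀ σ, 0 < g σ := fun σ => Real.sqrt_pos.2 (hq_pos σ)
    have hq_le : ∀ σ, q σ ≤ C ^ 2 := fun σ => by
      have hb : ∀ ω, |f ω ^ 2| ≤ C ^ 2 := fun ω => by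
        rw [abs_pow]; exact pow_le_pow_left₀ (abs_nonneg _) (hC ω) 2
      exact (le_abs_self _).trans (abs_bavg_le hγ (B n) hb σ)
    have hg_le : ∀ σ, |g σ| ≤ C := fun σ => by
      rw [abs_of_pos (hg_pos σ), hg, Real.sqrt_le_left hC0]; exact hq_le σ
    have hg_dep : DependsOn g ((↑(B n) : Set (Site d))ᶜ) := fun σ σ' h => by
      show Real.sqrt (q σ) = Real.sqrt (q σ')
      congr 1
      exact dependsOn_bavg hγ (B n) (hf.pow_const 2) h
    have hg_sq : ∀ σ, g σ ^ 2 = q σ := fun σ => Real.sq_sqrt (hq_pos σ).le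
    -- (4.21)
    haveI := hγ.isProbability (A n) τ
    have h21 := integral_sq_mul_log_le_of_LSI_of_dominated (μ := γ V τ) (ν := γ (A n) τ) (B n) (A n) hcA
      (hLA n hn) (hdom n hn) hgm ⟨C, hg_le⟩ hg_pos hg_dep
    -- the normalisation terms: `∫ g² dμ = ∫ f² dμ`
    have hgf : ∫ σ, g σ ^ 2 ∂(γ V τ) = ∫ σ, f σ ^ 2 ∂(γ V τ) := by
      simp only [hg_sq, hq]
      have hb : ∀ ω, |f ω ^ 2| ≤ C ^ 2 := fun ω => by
        rw [abs_pow]; exact pow_le_pow_left₀ (abs_nonneg _) (hC ω) 2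
      exact integral_integral_spec hγ (hBV n hn) τ (hf.pow_const 2) hb
    have hent_g : ∫ σ, q σ * Real.log (Real.sqrt (q σ)) ∂(γ V τ) = ∫ σ, g σ ^ 2 * Real.log (g σ) ∂(γ V τ) := by
      refine integral_congr_ae (Eventually.of_forall fun σ => ?_)
      show q σ * Real.log (Real.sqrt (q σ)) = g σ ^ 2 * Real.log (g σ)
      rw [hg_sq]
    rw [hent_g] at h20
    rw [hgf] at h21
    -- Lemma 4.7
    have h47n := h47 n hn f hf ⟨C, hC⟩ hpos
    -- `½μ|∇_B f|² + ½μ|∇_A f|² = ½μ|∇_V f|² + ½μ|∇_O f|²`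
    have hsplit : ∫ σ, gradSq (A n) f σ ∂(γ V τ) + ∫ σ, gradSq (B n) f σ ∂(γ V τ) =
        ∫ σ, gradSq V f σ ∂(γ V τ) + ∫ σ, gradSq (A n ∩ B n) f σ ∂(γ V τ) := by
      rw [← integral_add (hgi _) (hgi _), ← integral_add (hgi _) (hgi _)]
      refine integral_congr_ae (Eventually.of_forall fun σ => ?_)
      show gradSq (A n) f σ + gradSq (B n) f σ = gradSq V f σ + gradSq (A n ∩ B n) f σ
      unfold gradSq
      rw [← hcover n hn]
      exact Finset.sum_union_inter.symm
    -- the overlap form is dominated by the strip form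
    have hOmono : ∫ σ, gradSq (A n ∩ B n) f σ ∂(γ V τ) ≤ ∫ σ, gradSq (O n) f σ ∂(γ V τ) := by
      refine integral_mono (hgi _) (hgi _) fun σ => ?_
      show gradSq (A n ∩ B n) f σ ≤ gradSq (O n) f σ
      unfold gradSq
      exact Finset.sum_le_sum_of_subset_of_nonneg (hO n hn) fun x _ _ => sq_nonneg _
    -- assemble
    have hD0 : ∀ Λ : Finset (Site d), 0 ≤ ∫ σ, gradSq Λ f σ ∂(γ V τ) := fun Λ =>
      integral_nonneg fun σ => gradSq_nonneg _ _ _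
    have hA0 := hD0 (A n); have hB0 := hD0 (B n); have hO0 := hD0 (A n ∩ B n); have hV0 := hD0 V
    have hOO0 := hD0 (O n)
    have he0 : 0 ≤ (e : ℝ) ^ 2 * cA := by positivity
    unfold dirichletForm at h21
    have hmax1 : cB + (e : ℝ) ^ 2 * cA * η ≤ C₁ := le_max_left _ _
    have hmax2 : (e : ℝ) ^ 2 * cA ≤ C₁ := le_max_right _ _
    rw [hX]
    nlinarith [h20, h21, h47n, hsplit, mul_le_mul_of_nonneg_right hmax1 hB0,
      mul_le_mul_of_nonneg_right hmax2 hA0, mul_le_mul_of_nonneg_right hmax2 hO0,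
      mul_nonneg he0 (mul_nonneg hk₁ hOO0), mul_nonneg he0 (mul_nonneg hη hB0),
      mul_le_mul_of_nonneg_left hOmono hC₁0]
  -- average over `n`
  have havg := le_add_mul_dirichlet_div_of_disjoint (γ V τ) hN O hOV hdisj hf hC
    (by positivity : 0 ≤ C₁ + (e : ℝ) ^ 2 * cA * k₁) hper
  -- conclude
  have hN0 : (0 : ℝ) < N := by exact_mod_cast hN
  unfold dirichletForm
  rw [hX] at havg
  have e1 : C₁ * ((1 / 2) * ∫ σ, gradSq V f σ ∂(γ V τ)) +
      (C₁ + (e : ℝ) ^ 2 * cA * k₁) * ((1 / 2) * ∫ σ, gradSq V f σ ∂(γ V τ)) / N =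
      (C₁ * (1 + 1 / N) + (e : ℝ) ^ 2 * cA * k₁ / N) * ((1 / 2) * ∫ σ, gradSq V f σ ∂(γ V τ)) := by
    field_simp; ring
  linarith [havg, e1.le, e1.ge]

end Glauber

end Literature.Probability.LatticeModels

end
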